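import Summits.Schanuel.Schanuel.Theorems.DiophantineDichotomyApproximationPropertyCycleAPIOne
import Literature.NumberTheory.Transcendental.SixExponentialsSeveralVariablesAuxiliary
import Mathlib.Algebra.Order.Antidiag.FinsuppEquiv
import Mathlib.Data.Finsupp.MonomialOrder
import HarnessLib

/-!
# The box principle modulo a plane curve (stub C of the line `orbit-interpolation-determinant`)

Crux `Summit.Schanuel.Schanuel.Theses.DiophantineDichotomy.ApproximationProperty`
(stmt-Schanuel-6117), registered stub `stub_boxModCurve`: for `ω ∈ ℂ²` there is `c = c(ω) > 0`
such that for every non-zero ternary form `Q ∈ ℚ[x₀, x₁, x₂]` of degree `a ≥ 1` and all integers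
`b ≥ max(a, 10)`, `N ≥ 1` there is a form `R` of degree `b`, NOT in the ideal `(Q)`, with integer
coefficients of modulus `≤ N` (`1 ≤ |R| ≤ N`, `h(R) ≤ log N`) and
`|R(1, ω)| ≤ exp(c b − (ab/8) log(N+1))`.

Proof (Dirichlet's box principle on a monomial basis of `ℚ[x]_b / (Q)_b`):

* `(Q)_b = Q · ℚ[x]_{b−a}` has dimension `binom(b−a+2, 2)` (the hypersurface-section formula
  `Literature.RingTheory.MvPolynomial.finrank_idealDegree_sup_span_add_eq` with `I = 0` and
  `Literature.RingTheory.HilbertSamuel.finrank_homogeneousSubmodule_fin`);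
* by Macaulay's count `dim (Q)_b = #{leading exponents of (Q) of degree b}`
  (`Literature.RingTheory.MvPolynomial.finrank_idealDegree_eq_card`, lexicographic order) the set
  `B` of STANDARD monomials of degree `b` (those which are not a leading monomial of a member of
  `(Q)`) has `M₂ = binom(b+2,2) − binom(b−a+2,2) = a(2b−a+3)/2 ≥ (ab+3)/2` elements, and a non-zero
  polynomial supported on `B` is never in `(Q)` (its leading exponent would be a leading exponent
  of `(Q)`);
* the box principle `Literature.NumberTheory.Transcendental.Waldschmidt1981.box_principle_complex`
  for the single linear form `p ↦ ∑_{β ∈ B} p_β ω̄^β` (`|ω̄^β| ≤ max(1, ‖ω‖)^b`), with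
  `k = (N+1)^{⌊(M₂−1)/2⌋}`, `k² < (N+1)^{M₂}`, gives integers `p_β`, not all zero, `|p_β| ≤ N`,
  with `|∑ p_β ω̄^β| ≤ 2(2 M₂ max(1,‖ω‖)^b N + 1)/k ≤ 6 M₂ max(1,‖ω‖)^b (N+1)^{1−⌊(M₂−1)/2⌋}`, and
  `⌊(M₂−1)/2⌋ − 1 ≥ ab/8` because `ab ≥ 10`; `h(R) ≤ log |R|` for integer coefficients is
  `Literature.NumberTheory.Transcendental.Nesterenko.height_map_le_log_maxNorm` (as in the
  `t = 1` file `…CycleAPIOne`, whose `maxNorm_le_of_forall_le` is reused).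

The constant is `c = 5 + log max(1, ‖ω‖)`. Proofs only: no new definitions. Sources: Nesterenko–
Philippon (eds.), LNM 1752 (2001), Ch. 3 §4 (heights), Ch. 4 §4 (Philippon's approximation
property); M. Waldschmidt, Invent. Math. 63 (1981) §3 (box principle); Cox–Little–O'Shea Ch. 6 §3
(standard monomials).
-/

set_option linter.dupNamespace false

noncomputable section

namespace Summit.Schanuel.Schanuel.Cruxes.ApproximationProperty.OrbitInterpolationDeterminant

open Literature.NumberTheory.Transcendental.Nesterenko MvPolynomial Module
open scoped BigOperators

namespace BoxModCurve

open Literature.RingTheory.MvPolynomial (idealDegree idealDegree_bot leadingExponents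
  mem_leadingExponents finrank_idealDegree_eq_card finrank_idealDegree_sup_span_add_eq
  mem_finsuppAntidiag_univ_iff)

/-! ## The Hilbert function of a principal ideal of `ℚ[x₀, x₁, x₂]` -/

/-- **`dim (Q)_{t+a} = dim ℚ[x₀,x₁,x₂]_t = binom(t+2, 2)`** for a non-zero ternary form `Q` of
degree `a` (hypersurface section of the zero ideal by the non-zero-divisor `Q`). [folklore] -/
theorem finrank_idealDegree_span_singleton {Q : Rx 2} {a : ℕ} (hQ : Q.IsHomogeneous a)
    (hQ0 : Q ≠ 0) (t : ℕ) :
    finrank ℚ ↥(idealDegree (Ideal.span {Q}) (t + a)) = (t + 2).choose t := by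
  letI := MvPolynomial.gradedAlgebra (σ := Fin (2 + 1)) (R := ℚ)
  have h := finrank_idealDegree_sup_span_add_eq (I := (⊥ : Ideal (Rx 2)))
    (Ideal.IsHomogeneous.bot _) hQ0 hQ
    (fun f hf => by
      rw [Ideal.mem_bot] at hf ⊢
      exact (mul_eq_zero.mp hf).resolve_left hQ0) t
  rw [bot_sup_eq, idealDegree_bot, idealDegree_bot, finrank_bot, add_zero, zero_add,
    Literature.RingTheory.HilbertSamuel.finrank_homogeneousSubmodule_fin,
    show t + (2 + 1) - 1 = t + 2 by omega] at h
  exact h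

/-! ## Standard monomials of degree `b` modulo `(Q)` -/

/-- **A monomial basis of `ℚ[x]_b / (Q)_b`.** For a non-zero ternary form `Q` of degree `a ≤ b`
there is a set `B` of exponents of degree `b` with `#B + binom(b−a+2, 2) = binom(b+2, 2)`
(i.e. `#B = dim ℚ[x]_b − dim (Q)_b`) such that no non-zero polynomial supported on `B` lies in
`(Q)`: the standard monomials for the lexicographic order (Macaulay). [folklore] -/
theorem exists_standard_monomials {Q : Rx 2} {a b : ℕ} (hQ : Q.IsHomogeneous a) (hQ0 : Q ≠ 0)
    (hab : a ≤ b) :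
    ∃ B : Finset (Fin (2 + 1) →₀ ℕ), (∀ e ∈ B, e.degree = b) ∧
      B.card + (b - a + 2).choose (b - a) = (b + 2).choose b ∧
      ∀ R : Rx 2, R.support ⊆ B → R ∈ Ideal.span {Q} → R = 0 := by
  classical
  letI := MvPolynomial.gradedAlgebra (σ := Fin (2 + 1)) (R := ℚ)
  have hhom : (Ideal.span {Q}).IsHomogeneous (homogeneousSubmodule (Fin (2 + 1)) ℚ) :=
    Ideal.homogeneous_span _ _ fun x hx => ⟨a, by rw [Set.mem_singleton_iff.mp hx]; exact hQ⟩
  refine ⟨((Finset.univ : Finset (Fin (2 + 1))).finsuppAntidiag b).filter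
      fun e => e ∉ leadingExponents MonomialOrder.lex (Ideal.span {Q}), ?_, ?_, ?_⟩
  · intro e he
    exact mem_finsuppAntidiag_univ_iff.mp (Finset.mem_filter.mp he).1
  · have h1 := finrank_idealDegree_eq_card MonomialOrder.lex (Ideal.span {Q})
      (fun f hf d => homogeneousComponent_mem_of_mem hhom hf d) b
    have h2 := Finset.card_filter_add_card_filter_not
      (s := (Finset.univ : Finset (Fin (2 + 1))).finsuppAntidiag b)
      (fun e => e ∈ leadingExponents MonomialOrder.lex (Ideal.span {Q}))
    have h3 : ((Finset.univ : Finset (Fin (2 + 1))).finsuppAntidiag b).card = (b + 2).choose b := by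
      rw [Finset.card_finsuppAntidiag_nat_eq_choose, Finset.card_univ, Fintype.card_fin,
        show 2 + 1 + b - 1 = b + 2 by omega]
    have h4 := finrank_idealDegree_span_singleton hQ hQ0 (b - a)
    rw [Nat.sub_add_cancel hab] at h4
    omega
  · intro R hRB hRI
    by_contra hR0
    have hmem := hRB (MonomialOrder.degree_mem_support (m := MonomialOrder.lex) hR0)
    rw [Finset.mem_filter] at hmem
    exact hmem.2 ((mem_leadingExponents _).mpr ⟨R, hRI, hR0, rfl⟩)

/-! ## Arithmetic -/

/-- `2 binom(n+2, 2) = (n+2)(n+1)`. [folklore] -/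
theorem two_mul_choose_two : ∀ n : ℕ, 2 * (n + 2).choose n = (n + 2) * (n + 1)
  | 0 => by decide
  | n + 1 => by
    have ih := two_mul_choose_two n
    rw [Nat.choose_symm_add] at ih
    rw [Nat.choose_symm_add, show n + 1 + 2 = (n + 2) + 1 by rfl, Nat.choose_succ_succ',
      Nat.choose_one_right]
    nlinarith [ih]

/-- The count of standard monomials: from `#B + binom(b−a+2,2) = binom(b+2,2)`, `1 ≤ a ≤ b`:
`2 #B = a(2b − a + 3) ≥ ab + 3` and `#B ≤ (b+2)²`. [folklore] -/
theorem card_bounds {a b M : ℕ} (ha : 1 ≤ a) (hab : a ≤ b)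
    (hM : M + (b - a + 2).choose (b - a) = (b + 2).choose b) :
    a * b + 3 ≤ 2 * M ∧ M ≤ (b + 2) ^ 2 := by
  obtain ⟨d, rfl⟩ := Nat.exists_eq_add_of_le hab
  rw [Nat.add_sub_cancel_left] at hM
  have h1 := two_mul_choose_two (a + d)
  have h2 := two_mul_choose_two d
  have had : 0 ≤ a * d := Nat.zero_le _
  constructor
  · nlinarith [h1, h2, hM, had]
  · nlinarith [h1, h2, hM, had]

/-- **The final estimate.** With `A₀ ≥ 1`, `b ≥ 10`, `ab ≥ 10`, `N ≥ 1`, `ab + 3 ≤ 2M`,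
`M ≤ (b+2)²`, `M'' = ⌊(M−1)/2⌋`, `k = (N+1)^{M''}`: a quantity `V ≤ 2(2 M A₀^b N + 1)/k`
satisfies `V ≤ exp((5 + log A₀) b − (ab/8) log(N+1))`. [folklore] -/
theorem final_bound {A₀ V : ℝ} {a b N M M'' k : ℕ} (hA₀ : 1 ≤ A₀) (hb : 10 ≤ b)
    (hab : 10 ≤ a * b) (hN : 1 ≤ N) (hM : a * b + 3 ≤ 2 * M) (hMb : M ≤ (b + 2) ^ 2)
    (hM'' : M'' = (M - 1) / 2) (hk : k = (N + 1) ^ M'')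
    (hV : V ≤ 2 * ((2 * (M : ℝ) * A₀ ^ b * N + 1) / k)) :
    V ≤ Real.exp ((5 + Real.log A₀) * b - (a : ℝ) * b / 8 * Real.log ((N : ℝ) + 1)) := by
  have h8 : a * b + 8 ≤ 8 * M'' := by omega
  have hM1 : 1 ≤ M := by omega
  set L := Real.log ((N : ℝ) + 1) with hL
  have hN0 : (1 : ℝ) ≤ N := by exact_mod_cast hN
  have hL0 : 0 < L := Real.log_pos (by linarith)
  have hexpL : Real.exp L = (N : ℝ) + 1 := Real.exp_log (by linarith)
  have hkR : (k : ℝ) = Real.exp (M'' * L) := by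
    rw [Real.exp_nat_mul, hexpL, hk]
    push_cast
    ring
  have hk0 : (0 : ℝ) < k := by rw [hkR]; exact Real.exp_pos _
  have hA0 : 0 < A₀ := by linarith
  have hAb : A₀ ^ b = Real.exp (b * Real.log A₀) := by
    rw [Real.exp_nat_mul, Real.exp_log hA0]
  have hMR : (1 : ℝ) ≤ M := by exact_mod_cast hM1
  have hAb1 : 1 ≤ A₀ ^ b := one_le_pow₀ hA₀
  -- Step 1: `V ≤ 6 M A₀^b (N+1) / k`
  have h1 : V ≤ 6 * M * A₀ ^ b * ((N : ℝ) + 1) / k := by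
    refine hV.trans ?_
    rw [mul_div_assoc']
    apply div_le_div_of_nonneg_right _ hk0.le
    have hMA : 1 ≤ (M : ℝ) * A₀ ^ b := by nlinarith
    have hMAN : 0 ≤ (M : ℝ) * A₀ ^ b * N := by positivity
    nlinarith
  refine h1.trans ?_
  -- Step 2: everything as exponentials
  rw [div_le_iff₀ hk0, hkR, ← Real.exp_add, hAb, ← hexpL]
  have h6 : (6 : ℝ) ≤ Real.exp 6 := by linarith [Real.add_one_le_exp (6 : ℝ)]
  have hMexp : (M : ℝ) ≤ Real.exp ((b : ℝ) + 1) ^ 2 := by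
    have hb2 : (M : ℝ) ≤ ((b : ℝ) + 2) ^ 2 := by exact_mod_cast hMb
    have hb3 : (b : ℝ) + 2 ≤ Real.exp ((b : ℝ) + 1) := by
      linarith [Real.add_one_le_exp ((b : ℝ) + 1)]
    exact hb2.trans (pow_le_pow_left₀ (by positivity) hb3 2)
  have h8R : (a : ℝ) * b + 8 ≤ 8 * M'' := by exact_mod_cast h8
  have hML : ((a : ℝ) * b / 8 + 1) * L ≤ (M'' : ℝ) * L :=
    mul_le_mul_of_nonneg_right (by linarith) hL0.le
  have hbR : (10 : ℝ) ≤ b := by exact_mod_cast hb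
  have hlogA : 0 ≤ Real.log A₀ := Real.log_nonneg hA₀
  calc 6 * (M : ℝ) * Real.exp (b * Real.log A₀) * Real.exp L
      ≤ Real.exp 6 * Real.exp ((b : ℝ) + 1) ^ 2 * Real.exp (b * Real.log A₀) * Real.exp L :=
        mul_le_mul_of_nonneg_right (mul_le_mul_of_nonneg_right
          (mul_le_mul h6 hMexp (by positivity) (by positivity)) (by positivity)) (by positivity)
    _ = Real.exp (6 + ((b : ℝ) + 1) + ((b : ℝ) + 1) + b * Real.log A₀ + L) := by
        simp only [Real.exp_add, pow_two]; ring
    _ ≤ Real.exp ((5 + Real.log A₀) * b - (a : ℝ) * b / 8 * L + M'' * L) :=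
        Real.exp_le_exp.mpr (by nlinarith [hML, hbR, hlogA, hL0])

end BoxModCurve

/-- **Stub C — the box principle modulo a plane curve.** For `ω ∈ ℂ²` there is `c = c(ω) > 0`
such that for a non-zero form `Q` of degree `a ≥ 1` and integers `b ≥ max(a, 10)`, `N ≥ 1` some
form `R ∉ (Q)` of degree `b` with integer coefficients of modulus `≤ N` (`1 ≤ |R| ≤ N`,
`h(R) ≤ log N`) has `|R(1, ω)| ≤ exp(c b − (ab/8) log(N+1))` (Dirichlet's box principle on the
`M₂ = binom(b+2,2) − binom(b−a+2,2) ≥ (ab+3)/2` standard monomials of degree `b` modulo `(Q)`,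
with `k = (N+1)^{⌊(M₂−1)/2⌋}`; `c = 5 + log max(1, ‖ω‖)`). [folklore] -/
theorem stub_boxModCurve :
    ∀ ω : Fin 2 → ℂ, ∃ c : ℝ, 0 < c ∧ ∀ (Q : Rx 2) (a b N : ℕ), Q ≠ 0 → Q.IsHomogeneous a →
      1 ≤ a → a ≤ b → 10 ≤ b → 1 ≤ N →
      ∃ R : Rx 2, R ∉ Ideal.span {Q} ∧ R.IsHomogeneous b ∧ 1 ≤ maxNorm R ∧ maxNorm R ≤ N ∧
        height R ≤ Real.log N ∧
        ‖aeval (Fin.cons 1 ω : Fin (2 + 1) → ℂ) R‖ ≤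
          Real.exp (c * b - (a : ℝ) * b / 8 * Real.log ((N : ℝ) + 1)) := by
  intro ω
  have hA₀ : 1 ≤ max 1 ‖ω‖ := le_max_left _ _
  have hlogA₀ : 0 ≤ Real.log (max 1 ‖ω‖) := Real.log_nonneg hA₀
  refine ⟨5 + Real.log (max 1 ‖ω‖), by linarith, ?_⟩
  intro Q a b N hQ0 hQ ha hab hb hN
  classical
  obtain ⟨B, hBdeg, hBcard, hBind⟩ := BoxModCurve.exists_standard_monomials hQ hQ0 hab
  obtain ⟨hM, hMb⟩ := BoxModCurve.card_bounds ha hab hBcard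
  have hab10 : 10 ≤ a * b := by nlinarith
  -- the point `ω̄ = (1, ω)` and the values of the monomials at it
  set ω' : Fin (2 + 1) → ℂ := Fin.cons 1 ω with hω'def
  have hω' : ∀ i, ‖ω' i‖ ≤ max 1 ‖ω‖ := by
    refine Fin.cases ?_ ?_
    · simp [hω'def]
    · intro i
      rw [hω'def, Fin.cons_succ]
      exact (norm_le_pi_norm ω i).trans (le_max_right _ _)
  have hval : ∀ e : Fin (2 + 1) →₀ ℕ, e.degree = b →
      ‖e.prod fun i k => ω' i ^ k‖ ≤ (max 1 ‖ω‖) ^ b := by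
    intro e he
    rw [Finsupp.prod, norm_prod]
    calc ∏ i ∈ e.support, ‖ω' i ^ e i‖ ≤ ∏ i ∈ e.support, (max 1 ‖ω‖) ^ e i := by
          refine Finset.prod_le_prod (fun i _ => norm_nonneg _) fun i _ => ?_
          rw [norm_pow]
          exact pow_le_pow_left₀ (norm_nonneg _) (hω' i) _
      _ = (max 1 ‖ω‖) ^ b := by rw [Finset.prod_pow_eq_pow_sum, ← Finsupp.degree_apply, he]
  -- the box principle
  obtain ⟨M'', hM''⟩ : ∃ M'' : ℕ, M'' = (B.card - 1) / 2 := ⟨_, rfl⟩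
  obtain ⟨k, hk⟩ : ∃ k : ℕ, k = (N + 1) ^ M'' := ⟨_, rfl⟩
  have hk0 : 0 < k := by rw [hk]; positivity
  have hlt : k ^ (2 * Fintype.card (Fin 1)) < (N + 1) ^ Fintype.card ↥B := by
    rw [Fintype.card_coe, Fintype.card_fin, mul_one, hk, ← pow_mul]
    exact Nat.pow_lt_pow_right (by omega) (by omega)
  obtain ⟨p, hp0, hpN, hpsmall⟩ :=
    Literature.NumberTheory.Transcendental.Waldschmidt1981.box_principle_complex
      (fun (_ : Fin 1) (j : ↥B) => (j : Fin (2 + 1) →₀ ℕ).prod fun i k => ω' i ^ k)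
      (A := (max 1 ‖ω‖) ^ b) (by positivity) (fun _ j => hval j (hBdeg j j.2)) N k hk0 hlt
  -- the form `R = ∑ p_β x^β`
  obtain ⟨Z, hZ⟩ : ∃ Z : MvPolynomial (Fin (2 + 1)) ℤ,
      Z = ∑ j : ↥B, monomial (j : Fin (2 + 1) →₀ ℕ) (p j) := ⟨_, rfl⟩
  obtain ⟨R, hRZ⟩ : ∃ R : Rx 2, R = MvPolynomial.map (Int.castRingHom ℚ) Z := ⟨_, rfl⟩
  have hR : R = ∑ j : ↥B, monomial (j : Fin (2 + 1) →₀ ℕ) ((p j : ℤ) : ℚ) := by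
    rw [hRZ, hZ, map_sum]
    simp only [map_monomial, eq_intCast]
  have hcoeff : ∀ e, R.coeff e = if h : e ∈ B then ((p ⟨e, h⟩ : ℤ) : ℚ) else 0 := by
    intro e
    rw [hR, coeff_sum]
    simp only [coeff_monomial]
    split_ifs with h
    · rw [Finset.sum_eq_single (⟨e, h⟩ : ↥B)]
      · simp
      · intro j _ hj
        rw [if_neg]
        exact fun h' => hj (Subtype.ext h')
      · intro h'
        exact absurd (Finset.mem_univ _) h'
    · refine Finset.sum_eq_zero fun j _ => ?_
      rw [if_neg]
      rintro rfl
      exact h j.2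
  have hsupp : R.support ⊆ B := by
    intro e he
    by_contra h
    rw [MvPolynomial.mem_support_iff, hcoeff e, dif_neg h] at he
    exact he rfl
  obtain ⟨j₀, hj₀⟩ := Function.ne_iff.mp hp0
  have hj₀' : p j₀ ≠ 0 := by simpa using hj₀
  have hRj₀ : R.coeff j₀ = p j₀ := by rw [hcoeff, dif_pos j₀.2]
  have hR0 : R ≠ 0 := by
    intro h
    rw [h, coeff_zero] at hRj₀
    exact hj₀' (by exact_mod_cast hRj₀.symm)
  have hZ0 : Z ≠ 0 := fun h => hR0 (by rw [hRZ, h, map_zero])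
  have hmax1 : 1 ≤ maxNorm R := by
    refine le_trans ?_ (norm_coeff_le_maxNorm R j₀)
    rw [hRj₀, Int.norm_cast_rat, Int.norm_eq_abs]
    exact_mod_cast Int.one_le_abs hj₀'
  have hmaxN : maxNorm R ≤ N := by
    refine CycleAPIOne.maxNorm_le_of_forall_le R (Nat.cast_nonneg N) fun e => ?_
    rw [hcoeff]
    split_ifs with h
    · rw [Int.norm_cast_rat, Int.norm_eq_abs]
      have := hpN ⟨e, h⟩
      exact_mod_cast this
    · rw [norm_zero]
      exact Nat.cast_nonneg N
  refine ⟨R, fun hRI => hR0 (hBind R hsupp hRI), ?_, hmax1, hmaxN, ?_, ?_⟩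
  · rw [hR]
    exact IsHomogeneous.sum _ _ _ fun j _ => isHomogeneous_monomial _ (hBdeg _ j.2)
  · have hh := height_map_le_log_maxNorm Z hZ0
    rw [← hRZ] at hh
    exact hh.trans (Real.log_le_log (by linarith) hmaxN)
  · have hval_eq : aeval ω' R =
        ∑ j : ↥B, (p j : ℂ) * (j : Fin (2 + 1) →₀ ℕ).prod fun i k => ω' i ^ k := by
      rw [hR, map_sum]
      refine Finset.sum_congr rfl fun j _ => ?_
      rw [aeval_monomial, eq_ratCast, Rat.cast_intCast]
    rw [hval_eq]
    have h := hpsmall 0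
    simp only [Fintype.card_coe] at h
    exact BoxModCurve.final_bound hA₀ hb hab10 hN hM hMb hM'' hk h

end Summit.Schanuel.Schanuel.Cruxes.ApproximationProperty.OrbitInterpolationDeterminant

end
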